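import Summits.CriticalPhenomena.PercolationContinuityZ3.Theorems.PercNearOneGluingNoHeavyLowerTailSahiThreeCopyCellFaceCheck
import Summits.CriticalPhenomena.PercolationContinuityZ3.Theorems.PercNearOneGluingNoHeavyLowerTailSahiThreeCopyHitPairsSix

/-!
# `NoHeavyLowerTail` (crux stmt-CriticalPhenomena-4575), Sahi programme: the slot `C₆` for the cell checker — integer indicator, blocks, the
# invariance of `C₆` under pair-preserving relabellings, and the typed square-term constructor `mkSq` (definitions + two small lemmas)

Support file (Sahi cell, seat `prim-sahi-p1`, generation 65; `--supports stmt-CriticalPhenomena-4575`).  Companion of `…HitPairsSix` (gen 63: `c6B`, `C6set`,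
`prof6`, `frontGood_C6`), `…CellCheck` (`transScore`) and `…CellFaceCheck` (`SqTerm`).  No `sorry`, standard axioms. [this work]
-/

namespace Summit.CriticalPhenomena.PercolationContinuityZ3.Theorems.SahiThreeCopy

open Finset Function Literature.Combinatorics.Sahi2008
open scoped BigOperators

/-- Typed constructor for square-term data (keeps the elaboration of long literals cheap). [this work] -/
def mkSq (P Q : List ℕ) (M : List ℤ) : SqTerm := (P, Q, M)

/-- The integer indicator of `C₆`. [this work] -/
def c6Z (e : Pt 6) : ℤ := if c6B e then 1 else 0

/-- The three pairs of `C₆`. [this work] -/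
def blocksC6 : List (List (Fin 6)) := [[0, 1], [2, 3], [4, 5]]

/-- `setInd C6set` is the real cast of the integer indicator. [this work] -/
theorem setInd_C6set_eq : setInd C6set = fun x => (c6Z x : ℝ) := by
  funext x; rw [C6set, setInd_filter_eq]; unfold c6Z; split_ifs <;> simp

/-- Pull-back of the integer indicator along a relabelling that preserves `C₆`. [this work] -/
theorem c6Z_comp_relab_eq (σ : Equiv.Perm (Fin 6)) (hσ : C6set.map (relab σ).symm.toEmbedding = C6set) :
    (fun x => (c6Z x : ℝ)) ∘ relab σ = fun x => (c6Z x : ℝ) := by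
  rw [← setInd_C6set_eq, setInd_comp_relab, hσ]

/-- The interior front profile of `C₈` coded by a mask: `π_i = 2` iff bit `i` of `m`, else `1` (cf. `prof6`). [this work] -/
def prof8 (m : ℕ) : Fin 8 → ℕ := fun i => if m.testBit i.val then 2 else 1

/-- `prof8 0` is the all-ones profile `piOne8`. [this work] -/
theorem prof8_zero : prof8 0 = piOne8 := by
  funext i; simp [prof8, piOne8]

end Summit.CriticalPhenomena.PercolationContinuityZ3.Theorems.SahiThreeCopy
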